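import Literature.AlgebraicGeometry.Limits.SmoothProjectiveModelPrescribedBase
import Literature.AlgebraicGeometry.Limits.StageRestriction
import Literature.AlgebraicGeometry.Limits.GenericFibreSpread
import Literature.AlgebraicGeometry.Limits.IdealSheafExtension
import Literature.AlgebraicGeometry.Resolution.SpreadModelTower
import Literature.AlgebraicGeometry.RelativeSpec.ActionOverBaseChange
import HarnessLib

/-!
# Spreading out a smooth projective model of the generic fibre TOGETHER WITH a finite group action and an
# equivariant open chart (EGA IV₃ §8 on `Spec K = lim D(s)`; programme «M1», brick M1-4b — route-agnostic)

Topic `Literature/AlgebraicGeometry/Limits`. One theorem, no definition, no named fact. Written by the prover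
seat `hodge-nonav-prover-Bx` (g19, cell `hodge-nonav`), programme M1 (memo `PROGRAMME-M1-Bx-g19.md`) for route
`HodgeConjecture/Q8SymplecticPowers` (crux K1Q, stmt-HodgeConjecture-24190); sibling of
`SmoothProjectiveSpreadBirational` (QF-5a), whose «common open» proof it repeats with an OPEN IMMERSION
`θ : P_K ↪ E` (instead of a resolution `ρ : E → P_K`) and with a finite group `G` acting compatibly on `P`
(over `A`) and on `E` (over `K`).

Setting: `A` an integrally closed Noetherian domain with fraction field `K`; `P → Spec A` quasi-compact,
quasi-separated, locally of finite presentation and FLAT, with an action `ρP` of the finite group `G` over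
`Spec A`; `E` a smooth projective geometrically irreducible `K`-variety of dimension `n` with an action `ρE` of
`G` over `K`; a `G`-equivariant open `K`-immersion `θ : P ×_A Spec K ↪ E` with non-empty source. Conclusion
(`exists_projectiveModel_equivariant`): a projective `A`-model `emb : Pm ↪ ℙᴺ_A`, `f = emb ≫ (ℙᴺ_A → Spec A)`,
and `t ≠ 0` such that for every non-zero multiple `t'` of `t`: (i) over every model `T` of `A[1/t']`, `Pm_T → Spec T` is
proper, smooth of relative dimension `n` and geometrically irreducible (QF-2′ `exists_projectiveModel_forall_smooth_away`);
(ii) over `T = A[1/t']` (Mathlib `Localization.Away t'`), `G` acts (`σ`) on `Pm_T` over `Spec T` and there is a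
`G`-EQUIVARIANT OPEN IMMERSION `Θ : P_T ↪ Pm_T` over `Spec T`; (iii) `P_T → Spec T` is surjective (the chart meets every
fibre); (iv) `Pm` is a model of `E` — a cartesian square `gen : E ≅ Pm ×_A Spec K` — and, through the resulting generic-fibre map
`κ : E → Pm_T` (`κ ≫ fst = gen`, `κ ≫ snd = (E → Spec K → Spec T)`), `Θ` RESTRICTS TO `θ` on `P_K` (`(P_K → P_T) ≫ Θ = θ ≫ κ`) and
`σ` RESTRICTS TO `ρE` (`ρE(g) ≫ κ = κ ≫ σ(g)`).

Proof («common open»): the open `W ⊆ Pm` whose generic trace is `θ(P_K)` (`comap_map_eq_of_isPullback_generic`,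
`support_comap`) and the `K`-isomorphism `Φ : P_K ≅ W_K` (Mathlib `IsOpenImmersion.isoOfRangeEq`); the
compatible spreading of isomorphisms `LocApprox.exists_iso_whiskerLeft_leg_comp_eq` applied to `Φ` and to the
automorphisms `ρE(g)` read on `Pm_K ≅ E` (finitely many `g`); Chevalley for (iii)
(`exists_basicOpen_subset_range`); everything restricted to the common stage `D(t)` (`LocApprox.res`,
`Limits/StageRestriction`), where the group law and the equivariance are EQUALITIES of morphisms over `D(t)`
from the flat `P_t`, `Pm_t` to the separated `Pm_t` which hold on the scheme-theoretically dense generic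
fibre, hence hold (`LocApprox.ext_of_whiskerLeft_leg_comp_eq`, EGA IV₃ 11.10.5 ∕ 11.10.1). Honest scope:
general spreading-out; nothing here bears on HC.

## References

* [EGAIV3] A. Grothendieck, J. Dieudonné, EGA IV₃ (1966), Thm. 8.8.2, 8.10.5, 11.10.1, 11.10.5.
* [EGAIV4] EGA IV₄ (1967), Prop. 17.7.8.
* [GortzWedhorn2020] U. Görtz, T. Wedhorn, Algebraic Geometry I (2nd ed.), Thm. 10.63, Cor. 10.64.
* [StacksProject] The Stacks Project, Tags 01ZC, 081I, 0C0C, 0AY8.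
-/

noncomputable section

set_option backward.isDefEq.respectTransparency false

universe u

open CategoryTheory CategoryTheory.Limits AlgebraicGeometry TopologicalSpace MvPolynomial
  MonoidalCategory CartesianMonoidalCategory
open Literature.AlgebraicGeometry.Morphisms Literature.AlgebraicGeometry.Motives
open Literature.AlgebraicGeometry.HodgeTheory.SpreadingOutQbar
open Literature.AlgebraicGeometry.Resolution Literature.AlgebraicGeometry.RelativeSpec

namespace Literature.AlgebraicGeometry.Limits

attribute [local instance] MvPolynomial.gradedAlgebra

/-- **Spreading out a smooth projective model with a finite group action and an equivariant open chart**
(EGA IV₃ 8.8.2 ∕ 8.10.5 ∕ 11.10.5, IV₄ 17.7.8; Görtz–Wedhorn I Thm. 10.63 ∕ Cor. 10.64; see the module docstring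
for the setting, the conclusion (i)–(iii) and the proof). [cite: EGAIV3, Thm. 8.8.2 and Thm. 8.10.5]
[cite: EGAIV4, Prop. 17.7.8] [cite: GortzWedhorn2020, Thm. 10.63 and Cor. 10.64 (2), pp. 328–329]
[cite: StacksProject, Tag 0AY8] -/
theorem exists_projectiveModel_equivariant {A K : Type u} [CommRing A] [IsDomain A]
    [IsNoetherianRing A] [IsIntegrallyClosed A] [Field K] [Algebra A K] [IsFractionRing A K]
    {G : Type*} [Group G] [Finite G]
    (P : SchemeOver A) [QuasiCompact P.hom] [QuasiSeparated P.hom] [LocallyOfFinitePresentation P.hom]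
    [Flat P.hom] (ρP : ActionOver P.hom G)
    {n : ℕ} {E : SchemeOver K} (hE : IsSmoothProjective n E) (ρE : ActionOver E.hom G)
    (θ : (P ⊗ specOver A K).left ⟶ E.left) [IsOpenImmersion θ] (hθ : θ ≫ E.hom = (snd P (specOver A K)).left)
    (hθeq : ∀ g : G, ((ρP.tensorRight (specOver A K)).aut g).hom ≫ θ = θ ≫ (ρE.aut g).hom)
    [Nonempty ↥(P ⊗ specOver A K).left] :
    ∃ (N : ℕ) (Pm : Scheme.{u}) (emb : Pm ⟶ Proj (homogeneousSubmodule (Fin (N + 1)) A))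
      (_ : IsClosedImmersion emb) (gen : E.left ⟶ Pm) (t : A) (_ : t ≠ 0),
      IsPullback gen E.hom (emb ≫ ProjBaseChangeRing.projToSpec (Fin (N + 1)) A)
        (Spec.map (CommRingCat.ofHom (algebraMap A K))) ∧
      (∀ (t' : A), t ∣ t' → t' ≠ 0 → ∀ (T : Type u) [CommRing T] [Algebra A T] [IsLocalization.Away t' T],
        IsProper (pullback.snd (emb ≫ ProjBaseChangeRing.projToSpec (Fin (N + 1)) A)
          (Spec.map (CommRingCat.ofHom (algebraMap A T)))) ∧
        SmoothOfRelativeDimension n (pullback.snd (emb ≫ ProjBaseChangeRing.projToSpec (Fin (N + 1)) A)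
          (Spec.map (CommRingCat.ofHom (algebraMap A T)))) ∧
        GeometricallyIrreducible (pullback.snd (emb ≫ ProjBaseChangeRing.projToSpec (Fin (N + 1)) A)
          (Spec.map (CommRingCat.ofHom (algebraMap A T))))) ∧
      ∀ (t' : A) (_ : t ∣ t') (ht' : t' ≠ 0),
      ∃ (σ : ActionOver (pullback.snd (emb ≫ ProjBaseChangeRing.projToSpec (Fin (N + 1)) A)
            (Spec.map (CommRingCat.ofHom (algebraMap A (Localization.Away t'))))) G)
        (Θ : (P ⊗ specOver A (Localization.Away t')).left ⟶
            pullback (emb ≫ ProjBaseChangeRing.projToSpec (Fin (N + 1)) A)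
              (Spec.map (CommRingCat.ofHom (algebraMap A (Localization.Away t')))))
        (κ : E.left ⟶ pullback (emb ≫ ProjBaseChangeRing.projToSpec (Fin (N + 1)) A)
              (Spec.map (CommRingCat.ofHom (algebraMap A (Localization.Away t'))))),
        IsOpenImmersion Θ ∧
        Θ ≫ pullback.snd _ _ = (snd P (specOver A (Localization.Away t'))).left ∧
        (∀ g : G, ((ρP.tensorRight (specOver A (Localization.Away t'))).aut g).hom ≫ Θ = Θ ≫ (σ.aut g).hom) ∧
        Function.Surjective (snd P (specOver A (Localization.Away t'))).left ∧
        κ ≫ pullback.fst _ _ = gen ∧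
        κ ≫ pullback.snd _ _ =
          E.hom ≫ (LocApprox.leg (nonZeroDivisors A) K ⟨t', mem_nonZeroDivisors_of_ne_zero ht'⟩).left ∧
        (P ◁ LocApprox.leg (nonZeroDivisors A) K ⟨t', mem_nonZeroDivisors_of_ne_zero ht'⟩).left ≫ Θ = θ ≫ κ ∧
        (∀ g : G, (ρE.aut g).hom ≫ κ = κ ≫ (σ.aut g).hom) := by
  classical
  -- ### (1) the projective model over `A` (QF-2′)
  obtain ⟨N, Pm, emb, hemb, gen, t₀, ht₀, -, HK, Hloc⟩ :=
    exists_projectiveModel_forall_smooth_away (A := A) (K := K) hE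
  haveI := hemb
  haveI : IsProper (ProjBaseChangeRing.projToSpec (Fin (N + 1)) A) :=
    ProjBaseChangeRing.isProper_projToSpec _ A
  obtain ⟨f, hf⟩ : ∃ f : Pm ⟶ Spec (.of A), f = emb ≫ ProjBaseChangeRing.projToSpec (Fin (N + 1)) A :=
    ⟨_, rfl⟩
  have HK' := HK
  rw [← hf] at HK Hloc
  haveI : IsProper f := by rw [hf]; infer_instance
  haveI : LocallyOfFiniteType f := ‹IsProper f›.toLocallyOfFiniteType
  haveI : IsNoetherianRing (CommRingCat.of A) := ‹IsNoetherianRing A›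
  haveI : IsLocallyNoetherian (Spec (CommRingCat.of A)) :=
    (isLocallyNoetherian_Spec (R := CommRingCat.of A)).mpr ‹_›
  haveI : IsLocallyNoetherian Pm := LocallyOfFiniteType.isLocallyNoetherian f
  haveI : CompactSpace Pm := QuasiCompact.compactSpace_of_compactSpace f
  haveI : IsNoetherian Pm := {}
  haveI : LocallyOfFinitePresentation f := LocallyOfFinitePresentation.iff_locallyOfFiniteType.mpr ‹_›
  set jK : Spec (.of K) ⟶ Spec (.of A) := Spec.map (CommRingCat.ofHom (algebraMap A K)) with hjK
  haveI : QuasiCompact jK := inferInstance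
  haveI : QuasiCompact gen := MorphismProperty.of_isPullback HK.flip inferInstance
  -- the model as an `A`-scheme and its generic fibre `Pf ⊗ Spec K = Pm ×_A Spec K ≅ E`
  let Pf : SchemeOver A := Over.mk f
  haveI : QuasiCompact Pf.hom := inferInstanceAs (QuasiCompact f)
  haveI : QuasiSeparated Pf.hom := inferInstanceAs (QuasiSeparated f)
  haveI : LocallyOfFinitePresentation Pf.hom := inferInstanceAs (LocallyOfFinitePresentation f)
  let iK : E.left ≅ (Pf ⊗ specOver A K).left := HK.isoPullback
  have hiK_fst : iK.hom ≫ (fst Pf (specOver A K)).left = gen := HK.isoPullback_hom_fst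
  have hiK_snd : iK.hom ≫ (snd Pf (specOver A K)).left = E.hom := HK.isoPullback_hom_snd
  -- ### (2) the open `W ⊆ Pm` whose generic trace is the image of `θ`
  let V : E.left.Opens := θ.opensRange
  let C : Closeds E.left := V.compl
  let Z : Pm.IdealSheafData := (Scheme.IdealSheafData.vanishingIdeal C).map gen
  let W : Pm.Opens := Z.support.compl
  have hWgen : gen ⁻¹ᵁ W = V := by
    have h1 : (Z.comap gen) = Scheme.IdealSheafData.vanishingIdeal C :=
      comap_map_eq_of_isPullback_generic K f HK _
    have h2 : (Z.comap gen).support = Z.support.preimage gen.continuous :=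
      Scheme.IdealSheafData.support_comap Z gen
    rw [h1] at h2
    apply Opens.ext
    have h3 : ((Scheme.IdealSheafData.vanishingIdeal C).support : Set E.left) = C :=
      Scheme.IdealSheafData.coe_support_vanishingIdeal C
    have h4 : (gen ⁻¹ᵁ W : Set E.left) = (gen.base ⁻¹' (Z.support : Set Pm))ᶜ := by
      rfl
    rw [h4]
    have h5 : gen.base ⁻¹' (Z.support : Set Pm) = (C : Set E.left) := by
      rw [← h3, h2]; rfl
    rw [h5]
    exact compl_compl _
  -- ### (3) `P₁ = W ⊆ Pm` and the isomorphism `Φ : P ⊗ Spec K ≅ P₁ ⊗ Spec K` of generic fibres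
  let P₁ : SchemeOver A := Over.mk (W.ι ≫ f)
  haveI : QuasiCompact W.ι := quasiCompact_ι_of_isCompact W ((isCompact_iff_compactSpace.mpr inferInstance))
  haveI : QuasiCompact P₁.hom := inferInstanceAs (QuasiCompact (W.ι ≫ f))
  haveI : QuasiSeparated P₁.hom := inferInstanceAs (QuasiSeparated (W.ι ≫ f))
  haveI : LocallyOfFinitePresentation P₁.hom := inferInstanceAs (LocallyOfFinitePresentation (W.ι ≫ f))
  let wι : P₁ ⟶ Pf := Over.homMk W.ι rfl
  have hwι : ∀ Q : SchemeOver A, IsOpenImmersion (wι ▷ Q).left := fun Q =>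
    MorphismProperty.of_isPullback (LocApprox.isPullback_whiskerRight_left wι Q).flip
      (inferInstanceAs (IsOpenImmersion W.ι))
  let θ' : (P ⊗ specOver A K).left ⟶ (Pf ⊗ specOver A K).left := θ ≫ iK.hom
  haveI : IsOpenImmersion θ' := inferInstance
  haveI := hwι (specOver A K)
  have hrange : Set.range θ' = Set.range (wι ▷ specOver A K).left := by
    rw [LocApprox.range_whiskerRight_left wι (specOver A K)]
    have hr : Set.range wι.left = (W : Set Pm) := W.range_ι
    rw [hr]
    ext x
    constructor
    · rintro ⟨y, rfl⟩
      change (fst Pf (specOver A K)).left (iK.hom (θ y)) ∈ (W : Set Pm)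
      rw [← Scheme.Hom.comp_apply, hiK_fst]
      have hy : θ y ∈ (gen ⁻¹ᵁ W) := by rw [hWgen]; exact ⟨y, rfl⟩
      exact hy
    · intro hx
      have e1 : iK.inv ≫ gen = (fst Pf (specOver A K)).left := by
        rw [← hiK_fst, Iso.inv_hom_id_assoc]
      have hx' : gen (iK.inv x) ∈ W := by
        rw [← Scheme.Hom.comp_apply, e1]
        exact hx
      have hx'' : iK.inv x ∈ (gen ⁻¹ᵁ W) := hx'
      rw [hWgen] at hx''
      obtain ⟨y, hy⟩ := hx''
      refine ⟨y, ?_⟩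
      change iK.hom (θ y) = x
      rw [hy, ← Scheme.Hom.comp_apply, Iso.inv_hom_id]
      rfl
  let Φl : (P ⊗ specOver A K).left ≅ (P₁ ⊗ specOver A K).left :=
    IsOpenImmersion.isoOfRangeEq θ' (wι ▷ specOver A K).left hrange
  have hΦl : Φl.hom ≫ (wι ▷ specOver A K).left = θ' := IsOpenImmersion.isoOfRangeEq_hom_fac _ _ _
  have hθ'snd : θ' ≫ (snd Pf (specOver A K)).left = (snd P (specOver A K)).left := by
    change (θ ≫ iK.hom) ≫ _ = _
    rw [Category.assoc, hiK_snd, hθ]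
  have hΦlsnd : Φl.hom ≫ (snd P₁ (specOver A K)).left = (snd P (specOver A K)).left := by
    have e1 : (snd P₁ (specOver A K)).left = (wι ▷ specOver A K).left ≫ (snd Pf (specOver A K)).left := by
      rw [← Over.comp_left, whiskerRight_snd]
    rw [e1, ← Category.assoc, hΦl, hθ'snd]
  have hwP : (P ⊗ specOver A K).hom = (snd P (specOver A K)).left ≫ jK :=
    (Over.w (snd P (specOver A K))).symm
  have hwP₁ : (P₁ ⊗ specOver A K).hom = (snd P₁ (specOver A K)).left ≫ jK :=
    (Over.w (snd P₁ (specOver A K))).symm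
  let Φ : P ⊗ specOver A K ≅ P₁ ⊗ specOver A K :=
    Over.isoMk Φl (by rw [hwP, hwP₁, ← Category.assoc, hΦlsnd])
  have hΦ : Φ.hom ≫ snd P₁ (specOver A K) = snd P (specOver A K) := Over.OverMorphism.ext hΦlsnd
  have hΦwι : (Φ.hom ≫ (wι ▷ specOver A K)).left = θ' := hΦl
  -- ### (4) the automorphisms `ρE(g)` read on `Pf ⊗ Spec K`, and the spreadings
  let kO : G → (Pf ⊗ specOver A K ≅ Pf ⊗ specOver A K) := fun g =>
    Over.isoMk (iK.symm ≪≫ ρE.aut g ≪≫ iK) (by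
      change (iK.inv ≫ (ρE.aut g).hom ≫ iK.hom) ≫ (Pf ⊗ specOver A K).hom = (Pf ⊗ specOver A K).hom
      rw [← Over.w (snd Pf (specOver A K)), Category.assoc, Category.assoc, reassoc_of% hiK_snd,
        reassoc_of% (ρE.aut_comp g), ← reassoc_of% hiK_snd, Iso.inv_hom_id_assoc])
  have hkO_left : ∀ g, (kO g).hom.left = iK.inv ≫ (ρE.aut g).hom ≫ iK.hom := fun g => rfl
  have hkO : ∀ g, (kO g).hom ≫ snd Pf (specOver A K) = snd Pf (specOver A K) := fun g =>
    Over.OverMorphism.ext (by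
      change (iK.inv ≫ (ρE.aut g).hom ≫ iK.hom) ≫ (snd Pf (specOver A K)).left = (snd Pf (specOver A K)).left
      rw [Category.assoc, Category.assoc, hiK_snd, ρE.aut_comp g, ← hiK_snd, Iso.inv_hom_id_assoc])
  have hkO_mul : ∀ g h : G, (kO (g * h)).hom = (kO h).hom ≫ (kO g).hom := fun g h =>
    Over.OverMorphism.ext (by
      rw [Over.comp_left, hkO_left, hkO_left, hkO_left, map_mul, Aut.Aut_mul_def, Iso.trans_hom]
      simp only [Category.assoc, Iso.hom_inv_id_assoc])
  obtain ⟨s₀, e₀, he₀, hc₀⟩ :=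
    LocApprox.exists_iso_whiskerLeft_leg_comp_eq (nonZeroDivisors A) K Φ hΦ
  have hsp : ∀ g : G, ∃ (s : LocApprox.Idx (nonZeroDivisors A))
      (e : Pf ⊗ (LocApprox.baseDiagram (nonZeroDivisors A)).obj s ≅
        Pf ⊗ (LocApprox.baseDiagram (nonZeroDivisors A)).obj s),
      e.hom ≫ snd _ _ = snd _ _ ∧
        (Pf ◁ LocApprox.leg (nonZeroDivisors A) K s) ≫ e.hom =
          (kO g).hom ≫ (Pf ◁ LocApprox.leg (nonZeroDivisors A) K s) := fun g =>
    LocApprox.exists_iso_whiskerLeft_leg_comp_eq (nonZeroDivisors A) K (kO g) (hkO g)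
  choose sg eg heg hcg using hsp
  -- ### (5) `P` meets every fibre over some `D(b)`
  have sqP : IsPullback (fst P (specOver A K)).left (snd P (specOver A K)).left P.hom jK :=
    IsPullback.of_hasPullback _ _
  have hjKpt : ∀ z : Spec (.of K), jK z = (⊥ : PrimeSpectrum A) := by
    intro z
    apply PrimeSpectrum.ext
    change Ideal.comap (algebraMap A K) z.asIdeal = ⊥
    rw [Ideal.eq_bot_of_prime z.asIdeal, ← RingHom.ker_eq_comap_bot]
    exact (RingHom.injective_iff_ker_eq_bot _).mp (IsFractionRing.injective A K)
  obtain ⟨b, hb0, hbU⟩ : ∃ b : A, b ≠ 0 ∧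
      (PrimeSpectrum.basicOpen b : Set (PrimeSpectrum A)) ⊆ Set.range P.hom := by
    refine exists_basicOpen_subset_range P.hom ?_
    obtain ⟨x⟩ := ‹Nonempty ↥(P ⊗ specOver A K).left›
    refine ⟨(fst P (specOver A K)).left x, ?_⟩
    rw [← Scheme.Hom.comp_apply, sqP.w, Scheme.Hom.comp_apply]
    exact hjKpt _
  -- ### (6) the final stage `D(t)`, `t = t₀ · s₀ · (∏ s_g) · b`
  haveI : Fintype G := Fintype.ofFinite G
  have hs0 : s₀.val ≠ 0 := nonZeroDivisors.ne_zero s₀.mem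
  have hsg0 : (∏ g, (sg g).val) ≠ 0 :=
    Finset.prod_ne_zero_iff.mpr fun g _ => nonZeroDivisors.ne_zero (sg g).mem
  set tval : A := t₀ * s₀.val * (∏ g, (sg g).val) * b with htval
  have ht : tval ≠ 0 := mul_ne_zero (mul_ne_zero (mul_ne_zero ht₀ hs0) hsg0) hb0
  have ht₀t : t₀ ∣ tval := dvd_mul_of_dvd_left (dvd_mul_of_dvd_left (dvd_mul_right t₀ _) _) b
  have hs₀t : s₀.val ∣ tval := dvd_mul_of_dvd_left (dvd_mul_of_dvd_left (dvd_mul_left _ t₀) _) b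
  have hsgt : ∀ g, (sg g).val ∣ tval := fun g =>
    dvd_mul_of_dvd_left (dvd_mul_of_dvd_right (Finset.dvd_prod_of_mem _ (Finset.mem_univ g)) _) b
  refine ⟨N, Pm, emb, hemb, gen, tval, ht, HK', fun t' htt' ht' T _ _ _ => ?_, fun t' htt' ht' => ?_⟩
  · rw [← hf]
    exact Hloc _ (dvd_trans ht₀t htt') ht' T
  -- ### (7) at the stage `D(t') = Spec A[1/t']`, `t ∣ t'`
  rw [← hf]
  obtain ⟨k, rfl⟩ := htt'
  let tI : LocApprox.Idx (nonZeroDivisors A) := ⟨tval * k, mem_nonZeroDivisors_of_ne_zero ht'⟩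
  have h₀ : tI ⟶ s₀ := homOfLE (dvd_mul_of_dvd_left hs₀t k)
  have hg : ∀ g, tI ⟶ sg g := fun g => homOfLE (dvd_mul_of_dvd_left (hsgt g) k)
  let D : SchemeOver A := (LocApprox.baseDiagram (nonZeroDivisors A)).obj tI
  -- flatness and separatedness over the stage
  haveI : Flat (pullback.snd P.hom ((LocApprox.baseDiagram (nonZeroDivisors A)).obj tI).hom) :=
    inferInstance
  obtain ⟨-, hsm, -⟩ := Hloc _ (dvd_mul_of_dvd_left ht₀t k) ht' (Localization.Away (tval * k))
  haveI : Flat (pullback.snd Pf.hom ((LocApprox.baseDiagram (nonZeroDivisors A)).obj tI).hom) := by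
    haveI := hsm
    haveI : Smooth (pullback.snd f (Spec.map (CommRingCat.ofHom (algebraMap A (Localization.Away (tval * k)))))) :=
      SmoothOfRelativeDimension.smooth n _
    change Flat (pullback.snd f (Spec.map (CommRingCat.ofHom (algebraMap A (Localization.Away (tval * k))))))
    infer_instance
  haveI : IsSeparated Pf.hom := inferInstanceAs (IsSeparated f)
  haveI : IsSeparated (pullback.snd Pf.hom ((LocApprox.baseDiagram (nonZeroDivisors A)).obj tI).hom) :=
    inferInstance
  -- the spread automorphisms, restricted to the common stage
  let σi : G → (Pf ⊗ D ≅ Pf ⊗ D) := fun g => LocApprox.resIso (hg g) (eg g) (heg g)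
  have hσi_snd : ∀ g, (σi g).hom ≫ snd Pf D = snd Pf D := fun g => LocApprox.res_snd _ _
  have hσleg : ∀ g, (Pf ◁ LocApprox.leg (nonZeroDivisors A) K tI) ≫ (σi g).hom =
      (kO g).hom ≫ (Pf ◁ LocApprox.leg (nonZeroDivisors A) K tI) := fun g =>
    LocApprox.whiskerLeft_leg_comp_res (hg g) K (eg g).hom (heg g) (kO g).hom (hcg g)
  have hσmul : ∀ g h : G, (σi (g * h)).hom = (σi h).hom ≫ (σi g).hom := by
    intro g h
    refine LocApprox.ext_of_whiskerLeft_leg_comp_eq K _ _ (hσi_snd _)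
      (by rw [Category.assoc, hσi_snd, hσi_snd]) ?_
    rw [hσleg (g * h), reassoc_of% (hσleg h), hσleg g, ← Category.assoc, ← hkO_mul]
  let autT : G →* Aut (Pf ⊗ D).left :=
    MonoidHom.mk' (fun g => (Over.forget _).mapIso (σi g)) fun g h => by
      rw [Aut.Aut_mul_def, ← Functor.mapIso_trans]
      congr 1
      exact Iso.ext (hσmul g h)
  have hautT : ∀ g, (autT g).hom = (σi g).hom.left := fun g => rfl
  let σ : ActionOver (snd Pf D).left G :=
    ⟨autT, fun g => by rw [hautT, ← Over.comp_left, hσi_snd]⟩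
  -- the chart
  let Θo : P ⊗ D ⟶ Pf ⊗ D := LocApprox.res h₀ e₀.hom ≫ (wι ▷ D)
  have hΘo_snd : Θo ≫ snd Pf D = snd P D := by
    change (LocApprox.res h₀ e₀.hom ≫ (wι ▷ D)) ≫ snd Pf D = snd P D
    rw [Category.assoc, whiskerRight_snd, LocApprox.res_snd]
  have hΘleg : (P ◁ LocApprox.leg (nonZeroDivisors A) K tI) ≫ Θo =
      Φ.hom ≫ (wι ▷ specOver A K) ≫ (Pf ◁ LocApprox.leg (nonZeroDivisors A) K tI) := by
    change (P ◁ _) ≫ LocApprox.res h₀ e₀.hom ≫ (wι ▷ D) = _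
    rw [LocApprox.whiskerLeft_leg_comp_res_assoc h₀ K e₀.hom he₀ Φ.hom hc₀, ← whisker_exchange]
  have hΦl' : Φ.hom.left ≫ (wι ▷ specOver A K).left = θ' := hΦl
  have hequivK : ∀ g, ((ρP.overAut g).hom ▷ specOver A K) ≫ Φ.hom ≫ (wι ▷ specOver A K) =
      (Φ.hom ≫ (wι ▷ specOver A K)) ≫ (kO g).hom := by
    intro g
    apply Over.OverMorphism.ext
    simp only [Over.comp_left]
    rw [hΦl', hkO_left, ← ActionOver.tensorRight_aut_hom]
    change ((ρP.tensorRight (specOver A K)).aut g).hom ≫ θ ≫ iK.hom =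
      (θ ≫ iK.hom) ≫ iK.inv ≫ (ρE.aut g).hom ≫ iK.hom
    rw [reassoc_of% (hθeq g), Category.assoc, Iso.hom_inv_id_assoc]
  have hequiv : ∀ g, ((ρP.overAut g).hom ▷ D) ≫ Θo = Θo ≫ (σi g).hom := by
    intro g
    refine LocApprox.ext_of_whiskerLeft_leg_comp_eq K _ _
      (by rw [Category.assoc, hΘo_snd, whiskerRight_snd]) (by rw [Category.assoc, hσi_snd, hΘo_snd]) ?_
    rw [whisker_exchange_assoc, hΘleg, reassoc_of% hΘleg, hσleg g, reassoc_of% (hequivK g)]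
  haveI : IsIso (LocApprox.res h₀ e₀.hom).left :=
    inferInstanceAs (IsIso ((Over.forget _).map (LocApprox.resIso h₀ e₀ he₀).hom))
  haveI := hwι D
  have hΘo_left : Θo.left = (LocApprox.res h₀ e₀.hom).left ≫ (wι ▷ D).left := rfl
  -- the generic fibre `E ≅ Pf ⊗ Spec K` inside `Pf ⊗ D(t')`
  let κ : E.left ⟶ (Pf ⊗ D).left := iK.hom ≫ (Pf ◁ LocApprox.leg (nonZeroDivisors A) K tI).left
  have hκ_fst : κ ≫ (fst Pf D).left = gen := by
    change (iK.hom ≫ (Pf ◁ LocApprox.leg (nonZeroDivisors A) K tI).left) ≫ (fst Pf D).left = gen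
    rw [Category.assoc, ← Over.comp_left, whiskerLeft_fst, hiK_fst]
  have hκ_snd : κ ≫ (snd Pf D).left = E.hom ≫ (LocApprox.leg (nonZeroDivisors A) K tI).left := by
    change (iK.hom ≫ (Pf ◁ LocApprox.leg (nonZeroDivisors A) K tI).left) ≫ (snd Pf D).left = _
    rw [Category.assoc, ← Over.comp_left, whiskerLeft_snd, Over.comp_left, reassoc_of% hiK_snd]
  have hκΘ : (P ◁ LocApprox.leg (nonZeroDivisors A) K tI).left ≫ Θo.left = θ ≫ κ := by
    rw [← Over.comp_left, hΘleg, Over.comp_left, Over.comp_left, reassoc_of% hΦl']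
    change (θ ≫ iK.hom) ≫ _ = θ ≫ iK.hom ≫ _
    rw [Category.assoc]
  have hκσ : ∀ g, (ρE.aut g).hom ≫ κ = κ ≫ (σi g).hom.left := by
    intro g
    change (ρE.aut g).hom ≫ iK.hom ≫ (Pf ◁ LocApprox.leg (nonZeroDivisors A) K tI).left =
      (iK.hom ≫ (Pf ◁ LocApprox.leg (nonZeroDivisors A) K tI).left) ≫ (σi g).hom.left
    rw [Category.assoc, ← Over.comp_left, hσleg g, Over.comp_left, hkO_left]
    simp only [Category.assoc, Iso.hom_inv_id_assoc]
  refine ⟨σ, Θo.left, κ, ?_, ?_, fun g => ?_, ?_, hκ_fst, hκ_snd, hκΘ, hκσ⟩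
  · rw [hΘo_left]
    infer_instance
  · exact congrArg CommaMorphism.left hΘo_snd
  · change ((ρP.tensorRight D).aut g).hom ≫ Θo.left = Θo.left ≫ (σi g).hom.left
    rw [ActionOver.tensorRight_aut_hom, ← Over.comp_left, hequiv, Over.comp_left]
  · -- ### (iii) `P ⊗ D(t') → D(t')` is surjective
    intro y
    have hy : D.hom y ∈ (PrimeSpectrum.basicOpen (tval * k) : Set (PrimeSpectrum A)) := by
      have hr := PrimeSpectrum.localization_away_comap_range (Localization.Away (tval * k)) (tval * k)
      have e1 : D.hom y = PrimeSpectrum.comap (algebraMap A (Localization.Away (tval * k))) y := rfl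
      rw [e1, ← hr]
      exact ⟨y, rfl⟩
    have hDb : PrimeSpectrum.basicOpen (tval * k) ≤ PrimeSpectrum.basicOpen b :=
      (PrimeSpectrum.basicOpen_mul_le_left tval k).trans (PrimeSpectrum.basicOpen_mul_le_right _ b)
    obtain ⟨x, hx⟩ := hbU (hDb hy)
    obtain ⟨z, -, hz⟩ := Scheme.Pullback.exists_preimage_pullback x y hx
    exact ⟨z, hz⟩

end Literature.AlgebraicGeometry.Limits

end
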